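import Mathlib
import Summits.ValiantsHypothesis.ValiantsHypothesis.Theorems.KPlusLogSqLawWeakLiftingTowerGraftCornerPhantoms
import Summits.ValiantsHypothesis.ValiantsHypothesis.Theorems.KPlusLogSqLawWeakLiftingTowerGraftLinDescartes
import Summits.ValiantsHypothesis.ValiantsHypothesis.Theorems.LacunarySymmetroidMatrixDescartesProductPlusOnePowerSector
import Literature.LinearAlgebra.Matrix.SylvesterDeterminantIdentity

/-!
# Tower graft line — THE SKEW-BLOCK CORNER FAMILY: both digits rootless for every `η`, while the graft crosses at every root of `det B`

Calibration file for the line `Cruxes/WeakLifting/Lines/tower_graft.lean` (crux `WeakLifting` = stmt-ValiantsHypothesis-19561; S4b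
`stub_graftLawCorner`, memo `Lines/tower_graft-S5.md` §3 T1/T2).  NO stub is claimed.  Third calibration of this seat after
`…TowerGraftCornerPhantoms` (m = 2: `Z₊(A) = Z₊(E) = 0`, `Z₊(h) ≥ 2K − 3`; kill template #38) and the located `K = 2` family (phantoms ≈ m).

THE FAMILY.  Sizes `p + q` (think `p = q = k`, `m = 2k`), any number `K` of letters on any support `d`, a distinguished letter `l₀`, a real
`η ≠ 0`, and ARBITRARY rectangular blocks `B_l : p × q`:
  `S_{l₀} = [[η·1, B_{l₀}], [B_{l₀}ᵀ, −η·1]]`,  `S_l = [[0, B_l], [B_lᵀ, 0]]` (`l ≠ l₀`)   — symmetric letters;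
  `G(t) = Σ_l t^{d_l} S_l = [[η t^{d_{l₀}}·1, B(t)], [B(t)ᵀ, −η t^{d_{l₀}}·1]]`,  `B(t) = Σ_l t^{d_l} B_l`.
SCHUR (`det_skewBlock`): `det [[c·1_p, B],[Bᵀ, −c·1_q]] = c^p · (−c⁻¹)^q · det(c²·1_q + BᵀB)` for `c ≠ 0`, and `c²·1 + BᵀB ≻ 0`, so the
determinant NEVER vanishes (`det_skewBlock_ne_zero`).  Deleting a row and column of the second block gives the same shape with `B` replaced
by `B` minus a column (the tree's `Literature…fromBlocks_submatrix_sum_map`).  Hence (`card_posRoots_det_skewBlock_pencil_eq_zero`, `…_minor_eq_zero`):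
**for every `η ≠ 0` BOTH DIGITS of the corner graft at an index of the negative block — `A = det G` and `E = det Gᵢᵢ` — HAVE NO POSITIVE
ROOT AT ALL** (indeed no nonzero real root), for every `p, q, K, d, B`.
Meanwhile `h = A + X^D·E = (−1)^q (𝒜 − X^D ℰ)` with `𝒜 = det(η²t^{2d_{l₀}}·1 + BᵀB) = O(η²)` exactly at the roots of `det B` (p = q) and
`X^D ℰ = Θ(η)` there: for small `η` the graft crosses TWICE at every positive root of `det B` — LOCATED-EXACT in this seat's memo
(`HOME/val-sym-lift-p2/g19/exp/skewblock_k3.py`: k = 2, m = 4, K = 3, tower (1,5,21), D = 85, `det B` with 5 = ζ(2,3) positive roots,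
η = 10⁻¹³⁰: 10 certified sign changes of `h`), kernel for the quantitative half not in this file.  With `B` = the tree's Descartes-sharp
`(k,3)` tower pencils (`…KThreeColumnLawHolds.not_posRootLawAt_three`, ζ(k,3) = (k²+3k)/2) the phantom count is `k² + 3k = m²/4 + 3m/2`
with rootless digits: NO instance-level corner law `Z₊(h) ≤ c·(Z₊(A) + Z₊(E) + o(ζ₊))` survives — not with constants (#38), not with the
class floor `(m+1)(K−1)`; only the class MAXIMUM `ζ₊(m;d)` (S4b's own currency) pays.

Also recorded here (from the withdrawn CPL draft): the general-corner identity `det_add_smul_single_diag` (any index, any commutative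
ring), the line's corner letter `vecMulVec_single_one_map`, and the DIAGONAL-design law `card_posRoots_cornerGraft_diagonal_le`
(`Z₊(det(G + X^D·Eᵢᵢ)) ≤ Z₊(det Gᵢᵢ) + K` for diagonal letters — the one class where an instance law does hold).

HONEST FRAMING: linear algebra + Descartes bookkeeping; a calibration of what T2 must pay; nothing on S4/S4b/S5/S5ᴸ, TowerB, `WeakLifting`,
Conjecture B, `MatrixDescartes` (18050) or `VP ≠ VNP`.  Def-free.  Seat: prover val-sym-lift-p2 g19, `--supports stmt-ValiantsHypothesis-19561`.
-/

-- `Summit.ValiantsHypothesis.ValiantsHypothesis.…` repeats a component by the D-0017 layout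
-- (single-conjunct summit), which the `dupNamespace` linter flags; the name is mandated.
set_option linter.dupNamespace false

namespace Summit.ValiantsHypothesis.ValiantsHypothesis.Theorems.KPlusLogSqLaw.TowerGraft

open Polynomial Matrix
open scoped BigOperators Polynomial
open Summit.ValiantsHypothesis.ValiantsHypothesis.Theorems.LacunarySymmetroidMatrixDescartes.LocalMultiplicity
  (signVariations_le_card_support_sub_one)

/-! ## §1 General-corner bookkeeping -/

section Corner

/-- **corner graft along any diagonal entry**: `det (G + g·Eᵢᵢ) = det G + g · det Gᵢᵢ` (cofactor expansion; any commutative ring).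
[folklore] -/
theorem det_add_smul_single_diag {R : Type*} [CommRing R] {m : ℕ} (G : Matrix (Fin (m + 1)) (Fin (m + 1)) R)
    (i : Fin (m + 1)) (g : R) :
    (G + g • Matrix.single i i (1 : R)).det = G.det + g * (G.submatrix i.succAbove i.succAbove).det := by
  have h1 : G + g • Matrix.single i i (1 : R) = G.updateRow i (G i + g • Pi.single i (1 : R)) := by
    ext a b
    rcases eq_or_ne a i with rfl | ha
    · simp [Matrix.updateRow_self, Matrix.single, Pi.single_apply, eq_comm]
    · simp [Matrix.single, ha, ha.symm]
  rw [h1, Matrix.det_updateRow_add, Matrix.updateRow_eq_self, Matrix.det_updateRow_smul, ← Matrix.adjugate_apply,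
    Matrix.adjugate_fin_succ_eq_det_submatrix, ← two_mul, pow_mul]
  simp

/-- the line's corner letter is the coordinate matrix unit: `(vecMulVec eᵢ eᵢ).map C = Matrix.single i i 1`. [folklore] -/
theorem vecMulVec_single_one_map {m : ℕ} (i : Fin m) :
    (Matrix.vecMulVec (Pi.single i (1 : ℝ)) (Pi.single i (1 : ℝ))).map (C : ℝ →+* ℝ[X]) = Matrix.single i i (1 : ℝ[X]) := by
  refine Matrix.ext fun a b => ?_
  simp only [Matrix.map_apply, Matrix.vecMulVec_apply, Matrix.single_apply, Pi.single_apply]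
  by_cases ha : a = i
  · subst ha
    by_cases hb : b = a
    · subst hb; simp
    · simp [hb, Ne.symm hb]
  · simp [ha, Ne.symm ha]

/-- a real polynomial that does not vanish on `(0, ∞)` has no positive root. [folklore] -/
theorem card_posRoots_eq_zero_of_eval_ne_zero (P : ℝ[X]) (h : ∀ t : ℝ, 0 < t → P.eval t ≠ 0) :
    (P.roots.toFinset.filter (fun t => 0 < t)).card = 0 := by
  refine Finset.card_eq_zero.mpr (Finset.filter_eq_empty_iff.mpr fun t ht hpos => ?_)
  exact h t hpos (Polynomial.mem_roots'.mp (Multiset.mem_toFinset.mp ht)).2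

/-- **size one is Descartes outright**: for a `1 × 1` pencil `g = Σₗ X^{dₗ} sₗ` with `dₗ < D`, `Z₊(g + X^D) ≤ K`. [folklore] -/
theorem card_posRoots_corner_one_le {K D : ℕ} (d : Fin K → ℕ) (hD : ∀ l, d l < D) (s : Fin K → ℝ) :
    (((∑ l, (X : ℝ[X]) ^ d l * C (s l)) + (X : ℝ[X]) ^ D).roots.toFinset.filter (fun t => 0 < t)).card ≤ K := by
  classical
  set g : ℝ[X] := ∑ l, (X : ℝ[X]) ^ d l * C (s l) with hg
  rcases Nat.eq_zero_or_pos K with hK | hK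
  · subst hK
    have hg0 : g = 0 := by rw [hg]; simp
    rw [hg0, zero_add, Polynomial.roots_X_pow]
    refine (Finset.card_eq_zero.mpr (Finset.filter_eq_empty_iff.mpr fun t ht hpos => ?_)).le
    have h0 : t = 0 := Multiset.mem_singleton.mp (Multiset.mem_of_mem_nsmul (Multiset.mem_toFinset.mp ht))
    rw [h0] at hpos
    exact lt_irrefl _ hpos
  · obtain ⟨l₀, -, hl₀⟩ := Finset.exists_max_image Finset.univ d ⟨⟨0, hK⟩, Finset.mem_univ _⟩
    have hdeg : g.natDegree < D := by
      refine lt_of_le_of_lt ?_ (hD l₀)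
      rw [hg]
      refine natDegree_sum_le_of_forall_le _ _ fun l _ => ?_
      calc ((X : ℝ[X]) ^ d l * C (s l)).natDegree ≤ ((X : ℝ[X]) ^ d l).natDegree + (C (s l)).natDegree := natDegree_mul_le
        _ ≤ d l₀ := by rw [natDegree_C, add_zero, natDegree_X_pow]; exact hl₀ l (Finset.mem_univ l)
    have h1 := card_posRoots_add_X_pow_mul_le_signVariations hdeg (1 : ℝ[X])
    rw [mul_one] at h1
    have h2 : (1 : ℝ[X]).signVariations = 0 := by
      rw [show (1 : ℝ[X]) = monomial 0 1 from rfl]; exact signVariations_monomial 0 1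
    have h3 := signVariations_le_card_support_sub_one g
    have h4 : g.support.card ≤ K := by
      have e : g = ∑ l, C (s l) * (X : ℝ[X]) ^ d l := by rw [hg]; exact Finset.sum_congr rfl fun l _ => mul_comm _ _
      rw [e]
      exact Summit.ValiantsHypothesis.ValiantsHypothesis.Theorems.LacunarySymmetroidMatrixDescartes.PowerSector.card_support_fewnomial_le
        d s
    omega

/-- **THE DIAGONAL-DESIGN CORNER LAW (all sizes, all `K`).**  For DIAGONAL letters `Sₗ = diag(sₗ)` on a support with `dₗ < D`:
`det (G + X^D·Eᵢᵢ) = (gᵢ + X^D) · det Gᵢᵢ`, so `Z₊(det (G + X^D·Eᵢᵢ)) ≤ Z₊(det Gᵢᵢ) + K`. [this work] -/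
theorem card_posRoots_cornerGraft_diagonal_le {m K D : ℕ} (d : Fin K → ℕ) (hD : ∀ l, d l < D) (s : Fin K → Fin (m + 1) → ℝ)
    (i : Fin (m + 1)) :
    ((((∑ l, (X : ℝ[X]) ^ d l • (Matrix.diagonal (s l)).map C) +
          (X : ℝ[X]) ^ D • Matrix.single i i (1 : ℝ[X])).det).roots.toFinset.filter (fun t => 0 < t)).card ≤
      ((((∑ l, (X : ℝ[X]) ^ d l • (Matrix.diagonal (s l)).map C).submatrix i.succAbove i.succAbove).det).roots.toFinset.filter
          (fun t => 0 < t)).card + K := by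
  classical
  set g : Fin (m + 1) → ℝ[X] := fun j => ∑ l, (X : ℝ[X]) ^ d l * C (s l j) with hg
  have hG : (∑ l, (X : ℝ[X]) ^ d l • (Matrix.diagonal (s l)).map C) = Matrix.diagonal g := by
    have := Summit.ValiantsHypothesis.ValiantsHypothesis.Theorems.LacunarySymmetroidMatrixDescartes.DescartesSharp.pencil_diagonal
      d (fun j l => s l j)
    simpa [hg] using this
  rw [hG, det_add_smul_single_diag, Matrix.submatrix_diagonal _ _ Fin.succAbove_right_injective, Matrix.det_diagonal,
    Matrix.det_diagonal, Fin.prod_univ_succAbove g i]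
  set E : ℝ[X] := ∏ j : Fin m, (g ∘ i.succAbove) j with hE
  have hfac : g i * (∏ j : Fin m, g (i.succAbove j)) + (X : ℝ[X]) ^ D * E = (g i + (X : ℝ[X]) ^ D) * E := by
    rw [hE]; simp only [Function.comp]; ring
  rw [hfac]
  by_cases h0 : (g i + (X : ℝ[X]) ^ D) * E = 0
  · rw [h0]; simp
  rw [Polynomial.roots_mul h0, Multiset.toFinset_add, Finset.filter_union]
  refine (Finset.card_union_le _ _).trans ?_
  have h1 := card_posRoots_corner_one_le (D := D) d hD (fun l => s l i)
  rw [add_comm]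
  exact Nat.add_le_add le_rfl h1

end Corner

/-! ## §2 The skew-block family: both digits rootless -/

section SkewBlock

variable {p q : ℕ}

/-- `c²·1 + BᵀB` is positive definite for `c ≠ 0`. [folklore] -/
theorem posDef_sq_smul_one_add_transpose_mul_self (c : ℝ) (hc : c ≠ 0) (B : Matrix (Fin p) (Fin q) ℝ) :
    (c ^ 2 • (1 : Matrix (Fin q) (Fin q) ℝ) + Bᵀ * B).PosDef := by
  have h1 : (c ^ 2 • (1 : Matrix (Fin q) (Fin q) ℝ)).PosDef := Matrix.PosDef.one.smul (by positivity)
  have h2 : (Bᵀ * B).PosSemidef := by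
    simpa [Matrix.conjTranspose_eq_transpose_of_trivial] using Matrix.posSemidef_conjTranspose_mul_self B
  exact h1.add_posSemidef h2

/-- **SCHUR FOR THE SKEW BLOCK**: `det [[c·1_p, B],[Bᵀ, −c·1_q]] = c^p · (−c⁻¹)^q · det(c²·1_q + BᵀB)` (`c ≠ 0`). [folklore] -/
theorem det_skewBlock (c : ℝ) (hc : c ≠ 0) (B : Matrix (Fin p) (Fin q) ℝ) :
    (Matrix.fromBlocks (c • (1 : Matrix (Fin p) (Fin p) ℝ)) B Bᵀ (-(c • (1 : Matrix (Fin q) (Fin q) ℝ)))).det =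
      c ^ p * (-c⁻¹) ^ q * (c ^ 2 • (1 : Matrix (Fin q) (Fin q) ℝ) + Bᵀ * B).det := by
  haveI : Invertible (c • (1 : Matrix (Fin p) (Fin p) ℝ)) :=
    invertibleOfLeftInverse _ (c⁻¹ • (1 : Matrix (Fin p) (Fin p) ℝ)) (by
      rw [smul_mul_smul_comm, Matrix.one_mul, inv_mul_cancel₀ hc, one_smul])
  have hinv : ⅟(c • (1 : Matrix (Fin p) (Fin p) ℝ)) = c⁻¹ • (1 : Matrix (Fin p) (Fin p) ℝ) :=
    invOf_eq_left_inv (by rw [smul_mul_smul_comm, Matrix.one_mul, inv_mul_cancel₀ hc, one_smul])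
  rw [Matrix.det_fromBlocks₁₁, hinv, Matrix.det_smul, Matrix.det_one, mul_one, Fintype.card_fin]
  have hS : -(c • (1 : Matrix (Fin q) (Fin q) ℝ)) - Bᵀ * (c⁻¹ • (1 : Matrix (Fin p) (Fin p) ℝ)) * B =
      (-c⁻¹) • (c ^ 2 • (1 : Matrix (Fin q) (Fin q) ℝ) + Bᵀ * B) := by
    rw [Matrix.mul_smul, Matrix.mul_one, Matrix.smul_mul, smul_add, smul_smul, neg_mul, sq, ← mul_assoc, inv_mul_cancel₀ hc,
      one_mul, neg_smul, neg_smul]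
    abel
  rw [hS, Matrix.det_smul, Fintype.card_fin]
  ring

/-- the skew-block determinant never vanishes (`c ≠ 0`). [this work] -/
theorem det_skewBlock_ne_zero (c : ℝ) (hc : c ≠ 0) (B : Matrix (Fin p) (Fin q) ℝ) :
    (Matrix.fromBlocks (c • (1 : Matrix (Fin p) (Fin p) ℝ)) B Bᵀ (-(c • (1 : Matrix (Fin q) (Fin q) ℝ)))).det ≠ 0 := by
  rw [det_skewBlock c hc B]
  have h1 := (posDef_sq_smul_one_add_transpose_mul_self c hc B).det_pos
  have h2 : (c : ℝ) ^ p ≠ 0 := pow_ne_zero _ hc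
  have h3 : (-c⁻¹ : ℝ) ^ q ≠ 0 := pow_ne_zero _ (neg_ne_zero.mpr (inv_ne_zero hc))
  exact mul_ne_zero (mul_ne_zero h2 h3) h1.ne'

/-- block matrices sum blockwise. [folklore] -/
theorem fromBlocks_finset_sum {α : Type*} [AddCommMonoid α] {ι l₁ m₁ l₂ m₂ : Type*} (s : Finset ι) (A : ι → Matrix l₁ l₂ α)
    (B : ι → Matrix l₁ m₂ α) (C' : ι → Matrix m₁ l₂ α) (D : ι → Matrix m₁ m₂ α) :
    ∑ i ∈ s, Matrix.fromBlocks (A i) (B i) (C' i) (D i) =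
      Matrix.fromBlocks (∑ i ∈ s, A i) (∑ i ∈ s, B i) (∑ i ∈ s, C' i) (∑ i ∈ s, D i) := by
  classical
  induction s using Finset.induction_on with
  | empty => simp
  | insert a s ha ih => rw [Finset.sum_insert ha, ih, Matrix.fromBlocks_add]; simp [Finset.sum_insert ha]

/-- the skew-block PENCIL evaluated at a real point is the skew block of the evaluated `B`-pencil. [folklore] -/
theorem skewBlock_pencil_eval {K : ℕ} (d : Fin K → ℕ) (l₀ : Fin K) (η : ℝ) (B : Fin K → Matrix (Fin p) (Fin q) ℝ) (t : ℝ) :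
    (∑ l, t ^ d l • Matrix.fromBlocks (if l = l₀ then η • (1 : Matrix (Fin p) (Fin p) ℝ) else 0) (B l) (B l)ᵀ
        (if l = l₀ then -(η • (1 : Matrix (Fin q) (Fin q) ℝ)) else 0)) =
      Matrix.fromBlocks ((η * t ^ d l₀) • (1 : Matrix (Fin p) (Fin p) ℝ)) (∑ l, t ^ d l • B l) (∑ l, t ^ d l • B l)ᵀ
        (-((η * t ^ d l₀) • (1 : Matrix (Fin q) (Fin q) ℝ))) := by
  classical
  simp_rw [Matrix.fromBlocks_smul]
  rw [fromBlocks_finset_sum]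
  have h1 : (∑ l, t ^ d l • (if l = l₀ then η • (1 : Matrix (Fin p) (Fin p) ℝ) else 0)) =
      (η * t ^ d l₀) • (1 : Matrix (Fin p) (Fin p) ℝ) := by
    simp_rw [smul_ite, smul_zero, Finset.sum_ite_eq', Finset.mem_univ, if_true, smul_smul, mul_comm]
  have h2 : (∑ l, t ^ d l • (if l = l₀ then -(η • (1 : Matrix (Fin q) (Fin q) ℝ)) else 0)) =
      -((η * t ^ d l₀) • (1 : Matrix (Fin q) (Fin q) ℝ)) := by
    simp_rw [smul_ite, smul_zero, Finset.sum_ite_eq', Finset.mem_univ, if_true, smul_neg, smul_smul, mul_comm]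
  have h3 : (∑ l, t ^ d l • (B l)ᵀ) = (∑ l, t ^ d l • B l)ᵀ := by
    ext i j; simp [Matrix.sum_apply]
  rw [h1, h2, h3]

/-- `det` commutes with evaluation for pencils over any finite index type (cf. `eval_det_pencil` for `Fin m`). [folklore] -/
theorem eval_det_pencil_of_fintype {ι n : Type*} [Fintype ι] [Fintype n] [DecidableEq n] (S : ι → Matrix n n ℝ) (d : ι → ℕ) (t : ℝ) :
    ((∑ l, (X : ℝ[X]) ^ d l • (S l).map C).det).eval t = (∑ l, t ^ d l • S l).det := by
  have h := RingHom.map_det (Polynomial.evalRingHom t) (∑ l, (X : ℝ[X]) ^ d l • (S l).map C)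
  rw [Polynomial.coe_evalRingHom] at h
  rw [h, map_sum]
  congr 1
  refine Finset.sum_congr rfl fun l _ => ?_
  ext i j
  simp [Matrix.smul_apply]
  exact mul_comm _ _

/-- a reindexed pencil is the pencil of the reindexed letters (any index types; cf. the tree's `submatrix_pencil` for `Fin N`). [folklore] -/
theorem submatrix_pencil' {ι n n₁ n₂ : Type*} [Fintype ι] (d : ι → ℕ) (S : ι → Matrix n n ℝ) (ρ : n₁ → n) (γ : n₂ → n) :
    (∑ l, (X : ℝ[X]) ^ d l • (S l).map C).submatrix ρ γ = ∑ l, (X : ℝ[X]) ^ d l • ((S l).submatrix ρ γ).map C := by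
  ext i j
  simp [Matrix.submatrix_apply, Matrix.sum_apply, Matrix.smul_apply, Matrix.map_apply]

/-- **BOTH DIGITS ROOTLESS, I: the skew-block pencil's determinant has no positive (indeed no nonzero) root, for every `η ≠ 0`.**
[this work] -/
theorem card_posRoots_det_skewBlock_pencil_eq_zero {K : ℕ} (d : Fin K → ℕ) (l₀ : Fin K) {η : ℝ} (hη : η ≠ 0)
    (B : Fin K → Matrix (Fin p) (Fin q) ℝ) :
    ((∑ l, (X : ℝ[X]) ^ d l • (Matrix.fromBlocks (if l = l₀ then η • (1 : Matrix (Fin p) (Fin p) ℝ) else 0) (B l) (B l)ᵀ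
        (if l = l₀ then -(η • (1 : Matrix (Fin q) (Fin q) ℝ)) else 0)).map C).det.roots.toFinset.filter (fun t => 0 < t)).card = 0 := by
  classical
  refine card_posRoots_eq_zero_of_eval_ne_zero _ fun t ht => ?_
  rw [eval_det_pencil_of_fintype, skewBlock_pencil_eval]
  exact det_skewBlock_ne_zero _ (mul_ne_zero hη (pow_ne_zero _ ht.ne')) _

/-- **BOTH DIGITS ROOTLESS, II: the principal minor at an index of the negative block has no positive root either** (same shape, `B`
minus a column). [this work] -/
theorem card_posRoots_det_skewBlock_minor_eq_zero {K : ℕ} (d : Fin K → ℕ) (l₀ : Fin K) {η : ℝ} (hη : η ≠ 0)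
    (B : Fin K → Matrix (Fin p) (Fin (q + 1)) ℝ) (j : Fin (q + 1)) :
    (((∑ l, (X : ℝ[X]) ^ d l • (Matrix.fromBlocks (if l = l₀ then η • (1 : Matrix (Fin p) (Fin p) ℝ) else 0) (B l) (B l)ᵀ
        (if l = l₀ then -(η • (1 : Matrix (Fin (q + 1)) (Fin (q + 1)) ℝ)) else 0)).map C).submatrix
        (Sum.map id j.succAbove) (Sum.map id j.succAbove)).det.roots.toFinset.filter (fun t => 0 < t)).card = 0 := by
  classical
  -- the minor of the pencil is the pencil of the minors, which are again skew blocks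
  have hsub : (∑ l, (X : ℝ[X]) ^ d l • (Matrix.fromBlocks (if l = l₀ then η • (1 : Matrix (Fin p) (Fin p) ℝ) else 0) (B l) (B l)ᵀ
        (if l = l₀ then -(η • (1 : Matrix (Fin (q + 1)) (Fin (q + 1)) ℝ)) else 0)).map C).submatrix
        (Sum.map id j.succAbove) (Sum.map id j.succAbove) =
      ∑ l, (X : ℝ[X]) ^ d l • (Matrix.fromBlocks (if l = l₀ then η • (1 : Matrix (Fin p) (Fin p) ℝ) else 0)
        ((B l).submatrix id j.succAbove) ((B l).submatrix id j.succAbove)ᵀ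
        (if l = l₀ then -(η • (1 : Matrix (Fin q) (Fin q) ℝ)) else 0)).map C := by
    rw [submatrix_pencil']
    refine Finset.sum_congr rfl fun l _ => ?_
    rw [Literature.LinearAlgebra.Matrix.fromBlocks_submatrix_sum_map, ← Matrix.transpose_submatrix]
    have hD : (if l = l₀ then -(η • (1 : Matrix (Fin (q + 1)) (Fin (q + 1)) ℝ)) else 0).submatrix j.succAbove j.succAbove =
        (if l = l₀ then -(η • (1 : Matrix (Fin q) (Fin q) ℝ)) else 0) := by
      split_ifs
      · ext a b
        simp [Matrix.submatrix_apply, Matrix.one_apply, Fin.succAbove_right_injective.eq_iff]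
      · rfl
    rw [hD]
  rw [hsub]
  exact card_posRoots_det_skewBlock_pencil_eq_zero d l₀ hη _

/-- the skew-block letters are symmetric. [folklore] -/
theorem isSymm_skewBlock_letter {K : ℕ} (l₀ l : Fin K) (η : ℝ) (B : Fin K → Matrix (Fin p) (Fin q) ℝ) :
    (Matrix.fromBlocks (if l = l₀ then η • (1 : Matrix (Fin p) (Fin p) ℝ) else 0) (B l) (B l)ᵀ
      (if l = l₀ then -(η • (1 : Matrix (Fin q) (Fin q) ℝ)) else 0)).IsSymm := by
  refine Matrix.IsSymm.fromBlocks ?_ rfl ?_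
  · split_ifs
    · exact (Matrix.isSymm_one).smul _
    · exact Matrix.isSymm_zero
  · split_ifs
    · exact ((Matrix.isSymm_one).smul _).neg
    · exact Matrix.isSymm_zero

end SkewBlock

end Summit.ValiantsHypothesis.ValiantsHypothesis.Theorems.KPlusLogSqLaw.TowerGraft
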